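import Summits.CriticalPhenomena.CardyFormulaZ2.Theorems.CardyIKTransportIKLinearTransportWallDominationRingDefs
import Summits.CriticalPhenomena.CardyFormulaZ2.Theorems.CardyIKTransportIKMixedBoxCrossingTransportStubTriCylArcs

/-!
# `CardyIKTransport.IKLinearTransport` (stmt-CriticalPhenomena-5076), line `pinned-diagram-exchange`, lead c8 wave 2 —
# WALL DOMINATION: the site-`𝕋` input `stub_honThinRingChain : HonThinRingChain` (thin rings through the wall)

Support file (`--supports stmt-CriticalPhenomena-5076`, registered sub-goal `stub_honThinRingChain`).  On the ALL-HONEYCOMB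
slab of `n + n` face columns of the cylinder of circumference `8n` (site percolation `P_{1/2}` on `𝕋` drawn on the sites
`[0, 2n] × [0, 8n)` of `ℤ²`, the sister line's `TriCylArcsProof.cylProb_hon_eq` / `honCfg`) the chained thin-ring event
`thinRingChain n n (winA n (8n)) (winB n (8n))` of `…WallDominationRingDefs` has probability `≥ c > 0` uniformly in `n ≥ 1`.
Route (the sister line's `stub_triCylArcs` pattern with four crossings instead of three):
1. GLUING (`honCfg_mem_thinRingChain`, §1–§3): a left–right crossing `H⁺` of `[0, 2n] × [2n, 3n-1]`, one `H⁻` of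
   `[0, 2n] × [5n, 6n-1]`, a bottom–top crossing `V_L` of `[0, n] × [2n, 6n-1]` and one `V_R` of `[n, 2n] × [2n, 6n-1]` by sites
   of `ω` put `honCfg (n + n) (8n) ω` in the event: `u'`/`u` are the first/last visits of `H⁺` to the wall column `n`
   (`PathIn.exists_slab_crossing` on a tight support), the piece of `H⁺` left of `u'` meets `V_L` and the piece right of `u`
   meets `V_R` (`PathIn.tri_crossings_meet`), likewise for `H⁻` and `v'`/`v`; so `u ~ v` inside the right part and `u' ~ v'`
   inside the left part (`leftRel_of_pathIn`, `rightRel_of_pathIn`: the two parts of `honCfg (n + n)` are `honCfg n` of `ω`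
   and of a translate of `ω`, and `𝕋`-paths are black paths of the slab, `TriCylArcsProof.blackConn_of_pathIn`); and the
   piece of `H⁺` from `u'` to `u` splits at its crossings of the wall column into pieces inside one part each between
   consecutive wall sites, all of rows in the window (`chain_of_pathIn`), which is `chainRel`.
2. PROBABILITY (§4): Harris–FKG for the four increasing local events of the fair colouring (`sitePercolation_harris'`) and
   RSW on `𝕋` (`HoneycombStub.exists_rsw_const`, chaining `pow_mul_pow_le_triLRCrossingProb_of_le` at aspect `≤ 4`; the
   degenerate box of `n = 1` by `triLRCrossingProb_pos`).
No new definition; nothing of the tree is restated.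
-/

noncomputable section

namespace Summit.CriticalPhenomena.CardyFormulaZ2.Theorems.IKLinearTransport.PinnedDiagramExchange.WallDomination

open scoped BigOperators Classical
open MeasureTheory Finset
open Literature.Probability.Percolation Literature.Probability.LatticeModels
open Summit.CriticalPhenomena.CardyFormulaZ2.Cruxes.IKMixedBoxCrossing.DefectClosureExploration
open CylBunchStub (resLE)
open TriCylArcsProof

namespace HonThinRingStub

variable {n L : ℕ}

/-! ## §1 The two parts of the all-honeycomb slab and their black paths -/

/-- The LEFT part of the all-honeycomb slab of `n + n` face columns read from `ω` is the all-honeycomb slab of `n` face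
columns read from `ω`. -/
theorem resLE_honCfg (n L : ℕ) (ω : Set (Site 2)) :
    resLE (Nat.le_add_right n n) (honCfg (n + n) L ω) = honCfg n L ω := rfl

/-- The RIGHT part of the all-honeycomb slab of `n + n` face columns read from `ω` is the all-honeycomb slab of `n` face
columns read from the translate of `ω` by `-(n, 0)`. -/
theorem resGE_honCfg (n L : ℕ) (ω : Set (Site 2)) :
    resGE n n (honCfg (n + n) L ω) = honCfg n L {z | z + ![(n : ℤ), 0] ∈ ω} := by
  refine Prod.ext (funext fun c => ?_) rfl
  have hc : cellPt c + ![(n : ℤ), 0] = cellPt ((⟨n + c.1.val, by omega⟩ : Fin (n + n + 1)), c.2) := by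
    rw [Site.eq_iff_two]
    simp only [Pi.add_apply, cellPt_zero, cellPt_one, Matrix.cons_val_zero, Matrix.cons_val_one,
      Matrix.cons_val_fin_one]
    push_cast
    constructor <;> ring
  simp only [resGE, honCfg, Set.mem_setOf_eq, hc]

/-- The row of a site of `ℤ × [0, L)` read in `ℤ/L` has the representative `z 1`. -/
theorem val_row [NeZero L] {z : Site 2} (h0 : 0 ≤ z 1) (hL : z 1 < L) :
    ((((z 1 : ℤ) : ZMod L).val : ℕ) : ℤ) = z 1 := by
  rw [ZMod.val_intCast]
  exact Int.emod_eq_of_lt h0 hL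

/-- A wall site (`z 0 = n`) carries the middle cell, i.e. the LAST cell column of the left part. -/
theorem proj_wall_left {z : Site 2} (hz : z 0 = n) : proj n L z = (Fin.last n, ((z 1 : ℤ) : ZMod L)) :=
  Prod.ext (Fin.ext (by rw [Fin.val_last]; simp only [proj, hz, Int.toNat_natCast]; exact Nat.mod_eq_of_lt n.lt_succ_self))
    rfl

/-- Translated by `-(n, 0)`, a wall site carries the FIRST cell column of the (re-indexed) right part. -/
theorem proj_wall_right {z : Site 2} (hz : z 0 = n) :
    proj n L (z + -![(n : ℤ), 0]) = ((0 : Fin (n + 1)), ((z 1 : ℤ) : ZMod L)) :=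
  Prod.ext (Fin.ext (by simp [proj, hz])) (by simp [proj])

/-- A `𝕋`-path of sites of `ω` inside the left half `[0, n] × [0, L)` between two wall sites joins their middle cells by a
black path inside the LEFT part of `honCfg (n + n) L ω`. -/
theorem leftRel_of_pathIn [NeZero L] {ω U : Set (Site 2)}
    (hU : ∀ z ∈ U, (0 ≤ z 0 ∧ z 0 ≤ n ∧ 0 ≤ z 1 ∧ z 1 < L) ∧ z ∈ ω) {a b : Site 2}
    (h : PathIn triGraph U a b) (ha : a 0 = n) (hb : b 0 = n) :
    (((a 1 : ℤ) : ZMod L), ((b 1 : ℤ) : ZMod L)) ∈ leftRel n n (honCfg (n + n) L ω) := by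
  have key := blackConn_of_pathIn (w := n) (L := L) (ω := ω) hU h
  rw [proj_wall_left ha, proj_wall_left hb] at key
  show BlackConn (resLE _ (honCfg (n + n) L ω)) _ _
  rw [resLE_honCfg]
  exact key

/-- A `𝕋`-path of sites of `ω` inside the right half `[n, 2n] × [0, L)` between two wall sites joins their middle cells by
a black path inside the RIGHT part of `honCfg (n + n) L ω` (translate the path by `-(n, 0)`, `pathIn_shift`). -/
theorem rightRel_of_pathIn [NeZero L] {ω U : Set (Site 2)}
    (hU : ∀ z ∈ U, ((n : ℤ) ≤ z 0 ∧ z 0 ≤ 2 * n ∧ 0 ≤ z 1 ∧ z 1 < L) ∧ z ∈ ω) {a b : Site 2}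
    (h : PathIn triGraph U a b) (ha : a 0 = n) (hb : b 0 = n) :
    (((a 1 : ℤ) : ZMod L), ((b 1 : ℤ) : ZMod L)) ∈ rightRel n n (honCfg (n + n) L ω) := by
  have h' : PathIn triGraph
      {z : Site 2 | (0 ≤ z 0 ∧ z 0 ≤ n ∧ 0 ≤ z 1 ∧ z 1 < L) ∧ z ∈ {z : Site 2 | z + ![(n : ℤ), 0] ∈ ω}}
      (a + -![(n : ℤ), 0]) (b + -![(n : ℤ), 0]) := by
    refine pathIn_shift (-![(n : ℤ), 0]) (fun z hz => ?_) h
    obtain ⟨hz, hzω⟩ := hU z hz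
    refine ⟨?_, ?_⟩
    · simp only [Pi.add_apply, Pi.neg_apply, Matrix.cons_val_zero, Matrix.cons_val_one, Matrix.cons_val_fin_one]
      omega
    · simp only [Set.mem_setOf_eq, neg_add_cancel_right]
      exact hzω
  have key := blackConn_of_pathIn (w := n) (L := L) (fun z hz => hz) h'
  rw [proj_wall_right ha, proj_wall_right hb] at key
  show BlackConn (resGE n n (honCfg (n + n) L ω)) _ _
  rw [resGE_honCfg]
  exact key

/-! ## §2 Decomposition of a path of the slab at its wall visits -/

/-- DECOMPOSITION AT THE WALL VISITS.  A `𝕋`-path of sites of `ω` inside `[0, 2n] × [0, L)` all of whose rows lie in `W`,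
between two wall sites, splits at its crossings of the wall column `n` into pieces inside the left half and pieces inside
the right half between consecutive wall sites (a step of `𝕋` changes `z 0` by at most one, `triGraph_adj_coord`); hence its
end rows are `W`-chained (`chainRel`). -/
theorem chain_of_pathIn [NeZero L] {ω A : Set (Site 2)} {W : Set (ZMod L)}
    (hA : ∀ z ∈ A, ((0 ≤ z 0 ∧ z 0 ≤ 2 * n ∧ 0 ≤ z 1 ∧ z 1 < L) ∧ z ∈ ω) ∧ ((z 1 : ℤ) : ZMod L) ∈ W)
    {p q : Site 2} (h : PathIn triGraph A p q) (hp : p 0 = n) (hq : q 0 = n) :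
    chainRel n n W (honCfg (n + n) L ω) ((p 1 : ℤ) : ZMod L) ((q 1 : ℤ) : ZMod L) := by
  have hAl : ∀ z ∈ A ∩ {z : Site 2 | z 0 ≤ n}, (0 ≤ z 0 ∧ z 0 ≤ n ∧ 0 ≤ z 1 ∧ z 1 < L) ∧ z ∈ ω := fun z hz => by
    have h1 := (hA z hz.1).1
    have h2 : z 0 ≤ n := hz.2
    exact ⟨⟨h1.1.1, h2, h1.1.2.2.1, h1.1.2.2.2⟩, h1.2⟩
  have hAr : ∀ z ∈ A ∩ {z : Site 2 | (n : ℤ) ≤ z 0}, ((n : ℤ) ≤ z 0 ∧ z 0 ≤ 2 * n ∧ 0 ≤ z 1 ∧ z 1 < L) ∧ z ∈ ω :=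
    fun z hz => by
      have h1 := (hA z hz.1).1
      have h2 : (n : ℤ) ≤ z 0 := hz.2
      exact ⟨⟨h2, h1.1.2.1, h1.1.2.2.1, h1.1.2.2.2⟩, h1.2⟩
  -- closing a piece: the rows of its two wall ends are linked inside one part
  have close : ∀ m c : Site 2, m 0 = n → c 0 = n →
      (PathIn triGraph (A ∩ {z : Site 2 | z 0 ≤ n}) m c ∨ PathIn triGraph (A ∩ {z : Site 2 | (n : ℤ) ≤ z 0}) m c) →
      (((m 1 : ℤ) : ZMod L) ∈ W ∧ ((c 1 : ℤ) : ZMod L) ∈ W ∧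
        ((((m 1 : ℤ) : ZMod L), ((c 1 : ℤ) : ZMod L)) ∈ leftRel n n (honCfg (n + n) L ω) ∨
          (((m 1 : ℤ) : ZMod L), ((c 1 : ℤ) : ZMod L)) ∈ rightRel n n (honCfg (n + n) L ω))) := by
    intro m c hm hc hP
    rcases hP with hP | hP
    · exact ⟨(hA m hP.left_mem.1).2, (hA c hP.right_mem.1).2, Or.inl (leftRel_of_pathIn hAl hP hm hc)⟩
    · exact ⟨(hA m hP.left_mem.1).2, (hA c hP.right_mem.1).2, Or.inr (rightRel_of_pathIn hAr hP hm hc)⟩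
  obtain ⟨hpA, hpq⟩ := h
  suffices key : ∀ c, Relation.ReflTransGen (fun a b => triGraph.Adj a b ∧ b ∈ A) p c →
      ∃ m : Site 2, m 0 = n ∧ chainRel n n W (honCfg (n + n) L ω) ((p 1 : ℤ) : ZMod L) ((m 1 : ℤ) : ZMod L) ∧
        (PathIn triGraph (A ∩ {z : Site 2 | z 0 ≤ n}) m c ∨
          PathIn triGraph (A ∩ {z : Site 2 | (n : ℤ) ≤ z 0}) m c) by
    obtain ⟨m, hm, hch, hP⟩ := key q hpq
    exact Relation.ReflTransGen.tail hch (close m q hm hq hP)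
  intro c hpc
  induction hpc with
  | refl => exact ⟨p, hp, Relation.ReflTransGen.refl, Or.inl (PathIn.refl ⟨hpA, le_of_eq hp⟩)⟩
  | @tail c d _ hcd ih =>
    obtain ⟨m, hm, hch, hP⟩ := ih
    have h01 := triGraph_adj_coord hcd.1 0
    rcases hP with hP | hP
    · have hc : c 0 ≤ n := hP.right_mem.2
      by_cases hd : d 0 ≤ n
      · exact ⟨m, hm, hch, Or.inl (hP.tail hcd.1 ⟨hcd.2, hd⟩)⟩
      · have hc' : c 0 = n := by omega
        exact ⟨c, hc', Relation.ReflTransGen.tail hch (close m c hm hc' (Or.inl hP)),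
          Or.inr (PathIn.of_adj ⟨hP.right_mem.1, le_of_eq hc'.symm⟩ ⟨hcd.2, le_of_lt (not_le.1 hd)⟩ hcd.1)⟩
    · have hc : (n : ℤ) ≤ c 0 := hP.right_mem.2
      by_cases hd : (n : ℤ) ≤ d 0
      · exact ⟨m, hm, hch, Or.inr (hP.tail hcd.1 ⟨hcd.2, hd⟩)⟩
      · have hc' : c 0 = n := by omega
        exact ⟨c, hc', Relation.ReflTransGen.tail hch (close m c hm hc' (Or.inr hP)),
          Or.inl (PathIn.of_adj ⟨hP.right_mem.1, le_of_eq hc'⟩ ⟨hcd.2, le_of_lt (not_le.1 hd)⟩ hcd.1)⟩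

/-! ## §3 Gluing four crossings into the chained thin ring -/

/-- WALL VISITS OF A HORIZONTAL CROSSING.  A left–right crossing of `[0, 2n] × [b, b+n-1]` by sites of `ω` has a first visit
`u'` and a last visit `u` to the wall column `n` (`PathIn.exists_slab_crossing` on a tight support, `PathIn.exists_support`);
its piece left of `u'` meets every bottom–top crossing of `[0, n] × [b, b+n-1]` and its piece right of `u` every bottom–top
crossing of `[n, 2n] × [b, b+n-1]` (`PathIn.tri_crossings_meet`), and the rows of `u'`, `u` are `W`-chained when `W` contains
the rows `[b, b+n-1]` (`chain_of_pathIn`). -/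
theorem wall_visits [NeZero L] {ω K₁ K₂ : Set (Site 2)} {W : Set (ZMod L)} {b : ℤ} (hb : 0 ≤ b)
    (hbL : b + ((n - 1 : ℕ) : ℤ) < L)
    (hW : ∀ z : Site 2, b ≤ z 1 → z 1 ≤ b + ((n - 1 : ℕ) : ℤ) → ((z 1 : ℤ) : ZMod L) ∈ W)
    (hH : ω ∈ triHCross 0 b (2 * n) (n - 1))
    (hK₁ : ∀ z ∈ K₁, (0 ≤ z 0 ∧ z 0 ≤ n ∧ 0 ≤ z 1 ∧ z 1 < L) ∧ z ∈ ω)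
    (hV₁ : ∃ c d : Site 2, c 1 = b ∧ d 1 = b + ((n - 1 : ℕ) : ℤ) ∧
      PathIn triGraph (K₁ ∩ {z : Site 2 | b ≤ z 1 ∧ z 1 ≤ b + ((n - 1 : ℕ) : ℤ)}) c d)
    (hK₂ : ∀ z ∈ K₂, ((n : ℤ) ≤ z 0 ∧ z 0 ≤ 2 * n ∧ 0 ≤ z 1 ∧ z 1 < L) ∧ z ∈ ω)
    (hV₂ : ∃ c d : Site 2, c 1 = b ∧ d 1 = b + ((n - 1 : ℕ) : ℤ) ∧
      PathIn triGraph (K₂ ∩ {z : Site 2 | b ≤ z 1 ∧ z 1 ≤ b + ((n - 1 : ℕ) : ℤ)}) c d) :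
    ∃ u' u z₁ z₂ : Site 2, u' 0 = n ∧ u 0 = n ∧ (b ≤ u' 1 ∧ u' 1 ≤ b + ((n - 1 : ℕ) : ℤ)) ∧
      (b ≤ u 1 ∧ u 1 ≤ b + ((n - 1 : ℕ) : ℤ)) ∧
      chainRel n n W (honCfg (n + n) L ω) ((u' 1 : ℤ) : ZMod L) ((u 1 : ℤ) : ZMod L) ∧ z₁ ∈ K₁ ∧ z₂ ∈ K₂ ∧
      PathIn triGraph {z : Site 2 | (0 ≤ z 0 ∧ z 0 ≤ n ∧ 0 ≤ z 1 ∧ z 1 < L) ∧ z ∈ ω} u' z₁ ∧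
      PathIn triGraph {z : Site 2 | ((n : ℤ) ≤ z 0 ∧ z 0 ≤ 2 * n ∧ 0 ≤ z 1 ∧ z 1 < L) ∧ z ∈ ω} u z₂ := by
  obtain ⟨a, e, ha, he, hP⟩ := hH
  obtain ⟨T, hTS, hP', hTall⟩ := hP.exists_support
  have bT : ∀ z ∈ T, ((0 ≤ z 0 ∧ z 0 ≤ 2 * n ∧ 0 ≤ z 1 ∧ z 1 < L) ∧ z ∈ ω) ∧
      (b ≤ z 1 ∧ z 1 ≤ b + ((n - 1 : ℕ) : ℤ)) := fun z hz => by
    obtain ⟨hz, hzω⟩ := hTS hz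
    simp only [mem_triStrip] at hz
    exact ⟨⟨⟨by omega, by omega, by omega, by omega⟩, hzω⟩, hz.2.2.1, hz.2.2.2⟩
  -- the last wall visit `u` and the piece right of it; the first wall visit `u'` and the piece left of it
  obtain ⟨u, e', hu, he', hQ₂⟩ :=
    hP'.exists_slab_crossing 0 (L := (n : ℤ)) (R := 2 * n) (by omega) (by omega) (by omega)
  obtain ⟨a', u', ha', hu', hQ₁⟩ :=
    hP'.exists_slab_crossing 0 (L := 0) (R := (n : ℤ)) (by omega) (by omega) (by omega)
  obtain ⟨R₂, hR₂, hQ₂', hR₂all⟩ := hQ₂.exists_support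
  obtain ⟨R₁, hR₁, hQ₁', hR₁all⟩ := hQ₁.symm.exists_support
  have bR₁ : ∀ z ∈ R₁, (0 : ℤ) ≤ z 0 ∧ z 0 ≤ n ∧ b ≤ z 1 ∧ z 1 ≤ b + ((n - 1 : ℕ) : ℤ) := fun z hz =>
    ⟨(hR₁ hz).2.1, (hR₁ hz).2.2, (bT z (hR₁ hz).1).2.1, (bT z (hR₁ hz).1).2.2⟩
  have bR₂ : ∀ z ∈ R₂, (n : ℤ) ≤ z 0 ∧ z 0 ≤ 2 * n ∧ b ≤ z 1 ∧ z 1 ≤ b + ((n - 1 : ℕ) : ℤ) := fun z hz =>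
    ⟨(hR₂ hz).2.1, (hR₂ hz).2.2, (bT z (hR₂ hz).1).2.1, (bT z (hR₂ hz).1).2.2⟩
  obtain ⟨c₁, d₁, hc₁, hd₁, hV₁⟩ := hV₁
  obtain ⟨c₂, d₂, hc₂, hd₂, hV₂⟩ := hV₂
  -- the meeting sites with the two vertical crossings
  obtain ⟨z₁, hz₁R, hz₁K⟩ := PathIn.tri_crossings_meet (L := 0) (R := (n : ℤ)) (B := b)
    (T := b + ((n - 1 : ℕ) : ℤ)) bR₁ (fun z hz => ⟨(hK₁ z hz.1).1.1, (hK₁ z hz.1).1.2.1, hz.2.1, hz.2.2⟩)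
    hQ₁'.symm ha' hu' hV₁ hc₁ hd₁
  obtain ⟨z₂, hz₂R, hz₂K⟩ := PathIn.tri_crossings_meet (L := (n : ℤ)) (R := 2 * n) (B := b)
    (T := b + ((n - 1 : ℕ) : ℤ)) bR₂ (fun z hz => ⟨(hK₂ z hz.1).1.1, (hK₂ z hz.1).1.2.1, hz.2.1, hz.2.2⟩)
    hQ₂' hu he' hV₂ hc₂ hd₂
  have huT : u ∈ T := hQ₂.left_mem.1
  have hu'T : u' ∈ T := hQ₁.right_mem.1
  refine ⟨u', u, z₁, z₂, hu', hu, (bT u' hu'T).2, (bT u huT).2, ?_, hz₁K.1, hz₂K.1,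
    (hR₁all z₁ hz₁R).mono fun z hz => ?_, (hR₂all z₂ hz₂R).mono fun z hz => ?_⟩
  · exact chain_of_pathIn (fun z hz => ⟨(bT z hz).1, hW z (bT z hz).2.1 (bT z hz).2.2⟩)
      ((hTall u' hu'T).symm.trans (hTall u huT)) hu' hu
  · exact ⟨⟨(hR₁ hz).2.1, (hR₁ hz).2.2, (bT z (hR₁ hz).1).1.1.2.2.1, (bT z (hR₁ hz).1).1.1.2.2.2⟩,
      (bT z (hR₁ hz).1).1.2⟩
  · exact ⟨⟨(hR₂ hz).2.1, (hR₂ hz).2.2, (bT z (hR₂ hz).1).1.1.2.2.1, (bT z (hR₂ hz).1).1.1.2.2.2⟩,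
      (bT z (hR₂ hz).1).1.2⟩

/-- **Gluing.**  A left–right crossing of `[0, 2n] × [2n, 3n-1]`, one of `[0, 2n] × [5n, 6n-1]`, a bottom–top crossing of
`[0, n] × [2n, 6n-1]` and one of `[n, 2n] × [2n, 6n-1]` by sites of `ω` put the all-honeycomb slab configuration read from
`ω` in the chained thin-ring event: with `u', u` (`v', v`) the first and last wall visits of the upper (lower) horizontal
crossing (`wall_visits`), `u ~ v` inside the right part through the right vertical crossing and `u' ~ v'` inside the left part
through the left one (`rightRel_of_pathIn`, `leftRel_of_pathIn`), and the chains are those of `wall_visits`. -/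
theorem honCfg_mem_thinRingChain : ∀ (n : ℕ) [NeZero (8 * n)] (ω : Set (Site 2)), 1 ≤ n →
    ω ∈ triHCross 0 (2 * n) (2 * n) (n - 1) → ω ∈ triHCross 0 (5 * n) (2 * n) (n - 1) →
    ω ∈ triVCross 0 (2 * n) n (4 * n - 1) → ω ∈ triVCross n (2 * n) n (4 * n - 1) →
    TriCylArcsProof.honCfg (n + n) (8 * n) ω ∈ thinRingChain n n (winA n (8 * n)) (winB n (8 * n)) := by
  intro n _ ω hn hH₁ hH₂ hV₁ hV₂
  obtain ⟨x₁, y₁, hx₁, hy₁, hP₁⟩ := hV₁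
  obtain ⟨x₂, y₂, hx₂, hy₂, hP₂⟩ := hV₂
  obtain ⟨T₁, hT₁S, hP₁', hT₁all⟩ := hP₁.exists_support
  obtain ⟨T₂, hT₂S, hP₂', hT₂all⟩ := hP₂.exists_support
  have bT₁ : ∀ z ∈ T₁, (0 ≤ z 0 ∧ z 0 ≤ n ∧ 0 ≤ z 1 ∧ z 1 < ((8 * n : ℕ) : ℤ)) ∧ z ∈ ω := fun z hz => by
    obtain ⟨hz, hzω⟩ := hT₁S hz
    simp only [mem_triStrip] at hz
    exact ⟨⟨by omega, by omega, by omega, by omega⟩, hzω⟩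
  have bT₂ : ∀ z ∈ T₂, ((n : ℤ) ≤ z 0 ∧ z 0 ≤ 2 * n ∧ 0 ≤ z 1 ∧ z 1 < ((8 * n : ℕ) : ℤ)) ∧ z ∈ ω := fun z hz => by
    obtain ⟨hz, hzω⟩ := hT₂S hz
    simp only [mem_triStrip] at hz
    exact ⟨⟨by omega, by omega, by omega, by omega⟩, hzω⟩
  -- rows of the two strips lie in the two windows
  have hWA : ∀ z : Site 2, 2 * (n : ℤ) ≤ z 1 → z 1 ≤ 2 * (n : ℤ) + ((n - 1 : ℕ) : ℤ) →
      ((z 1 : ℤ) : ZMod (8 * n)) ∈ winA n (8 * n) := fun z h1 h2 => by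
    have := val_row (L := 8 * n) (z := z) (by omega) (by push_cast; omega)
    simp only [winA, Set.mem_setOf_eq]
    omega
  have hWB : ∀ z : Site 2, 5 * (n : ℤ) ≤ z 1 → z 1 ≤ 5 * (n : ℤ) + ((n - 1 : ℕ) : ℤ) →
      ((z 1 : ℤ) : ZMod (8 * n)) ∈ winB n (8 * n) := fun z h1 h2 => by
    have := val_row (L := 8 * n) (z := z) (by omega) (by push_cast; omega)
    simp only [winB, Set.mem_setOf_eq]
    omega
  -- wall visits of the two horizontal crossings (the vertical crossings cross both strips, `exists_slab_crossing`)
  obtain ⟨u', u, z₁, z₂, hu', hu, bu', bu, hchA, hz₁, hz₂, hp₁, hp₂⟩ :=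
    wall_visits (L := 8 * n) (W := winA n (8 * n)) (b := 2 * (n : ℤ)) (by positivity) (by push_cast; omega) hWA hH₁
      bT₁ (hP₁'.exists_slab_crossing 1 (by omega) (by omega) (by omega))
      bT₂ (hP₂'.exists_slab_crossing 1 (by omega) (by omega) (by omega))
  obtain ⟨v', v, z₃, z₄, hv', hv, bv', bv, hchB, hz₃, hz₄, hp₃, hp₄⟩ :=
    wall_visits (L := 8 * n) (W := winB n (8 * n)) (b := 5 * (n : ℤ)) (by positivity) (by push_cast; omega) hWB hH₂
      bT₁ (hP₁'.exists_slab_crossing 1 (by omega) (by omega) (by omega))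
      bT₂ (hP₂'.exists_slab_crossing 1 (by omega) (by omega) (by omega))
  -- `u' ~ v'` inside the left part through the left vertical crossing, `u ~ v` inside the right part through the right one
  have hl : PathIn triGraph {z : Site 2 | (0 ≤ z 0 ∧ z 0 ≤ n ∧ 0 ≤ z 1 ∧ z 1 < ((8 * n : ℕ) : ℤ)) ∧ z ∈ ω} u' v' :=
    (hp₁.trans (((hT₁all z₁ hz₁).symm.trans (hT₁all z₃ hz₃)).mono fun z hz => bT₁ z hz)).trans hp₃.symm
  have hr : PathIn triGraph
      {z : Site 2 | ((n : ℤ) ≤ z 0 ∧ z 0 ≤ 2 * n ∧ 0 ≤ z 1 ∧ z 1 < ((8 * n : ℕ) : ℤ)) ∧ z ∈ ω} u v :=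
    (hp₂.trans (((hT₂all z₂ hz₂).symm.trans (hT₂all z₄ hz₄)).mono fun z hz => bT₂ z hz)).trans hp₄.symm
  exact ⟨_, hWA u bu.1 bu.2, _, hWA u' bu'.1 bu'.2, _, hWB v bv.1 bv.2, _, hWB v' bv'.1 bv'.2,
    rightRel_of_pathIn (fun z hz => hz) hr hu hv, leftRel_of_pathIn (fun z hz => hz) hl hu' hv', hchA, hchB⟩

/-! ## §4 Probability: Harris–FKG and RSW on `𝕋` -/

/-- **Harris.**  `P(H⁺) P(H⁻) (P(V_L) P(V_R))` is at most the all-honeycomb slab probability of the chained thin-ring event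
(increasing local events of the i.i.d. fair colouring, `sitePercolation_harris'` three times; the slab law is that colouring,
`cylProb_hon_eq`; the gluing `honCfg_mem_thinRingChain`). -/
theorem prod_le_cylProb (hn : 1 ≤ n) [NeZero (8 * n)] :
    (sitePercolation (Site 2) half).real (triHCross 0 (2 * n) (2 * n) (n - 1)) *
        (sitePercolation (Site 2) half).real (triHCross 0 (5 * n) (2 * n) (n - 1)) *
        ((sitePercolation (Site 2) half).real (triVCross 0 (2 * n) n (4 * n - 1)) *
          (sitePercolation (Site 2) half).real (triVCross n (2 * n) n (4 * n - 1))) ≤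
      cylProb (n + n) (8 * n) (fun _ => false) (thinRingChain n n (winA n (8 * n)) (winB n (8 * n))) := by
  rw [cylProb_hon_eq]
  have d1 := determinedBy_triHCross 0 (2 * n) (2 * n) (n - 1)
  have d2 := determinedBy_triHCross 0 (5 * n) (2 * n) (n - 1)
  have d3 := determinedBy_triVCross 0 (2 * n) n (4 * n - 1)
  have d4 := determinedBy_triVCross n (2 * n) n (4 * n - 1)
  have u1 := isUpperSet_triHCross 0 (2 * n) (2 * n) (n - 1)
  have u2 := isUpperSet_triHCross 0 (5 * n) (2 * n) (n - 1)
  have u3 := isUpperSet_triVCross 0 (2 * n) n (4 * n - 1)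
  have u4 := isUpperSet_triVCross n (2 * n) n (4 * n - 1)
  have d12 : DeterminedBy (triHCross 0 (2 * n) (2 * n) (n - 1) ∩ triHCross 0 (5 * n) (2 * n) (n - 1))
      ↑(triStripFinset 0 (2 * n) (2 * n) (n - 1) ∪ triStripFinset 0 (5 * n) (2 * n) (n - 1)) :=
    (d1.mono (by simp)).inter (d2.mono (by simp))
  have d34 : DeterminedBy (triVCross 0 (2 * n) n (4 * n - 1) ∩ triVCross n (2 * n) n (4 * n - 1))
      ↑(triStripFinset 0 (2 * n) n (4 * n - 1) ∪ triStripFinset n (2 * n) n (4 * n - 1)) :=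
    (d3.mono (by simp)).inter (d4.mono (by simp))
  have h12 := sitePercolation_harris' half d1 d2 u1 u2
  have h34 := sitePercolation_harris' half d3 d4 u3 u4
  have h1234 := sitePercolation_harris' half d12 d34 (u1.inter u2) (u3.inter u4)
  refine ((mul_le_mul h12 h34 (mul_nonneg measureReal_nonneg measureReal_nonneg) measureReal_nonneg).trans
    h1234).trans (measureReal_mono ?_ (measure_ne_top _ _))
  rintro ω ⟨⟨h1, h2⟩, h3, h4⟩
  exact honCfg_mem_thinRingChain n ω hn h1 h2 h3 h4

/-- **RSW input.**  A constant `c > 0` below `P(H⁺) P(H⁻) (P(V_L) P(V_R))` for every `n ≥ 1`: all four are long-way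
crossings of aspect `≤ 4` (`(2n+1) × n` and `4n × (n+1)` boxes), bounded below by chaining
(`pow_mul_pow_le_triLRCrossingProb_of_le` with `j = 3` from `exists_rsw_const` and width antitonicity) for `n ≥ 2`, resp.
`n ≥ 1`; the horizontal box of `n = 1` is a single row, crossed with a fixed positive probability (`triLRCrossingProb_pos`). -/
theorem exists_const_le_prod4 : ∃ c : ℝ, 0 < c ∧ ∀ n : ℕ, 1 ≤ n →
    c ≤ (sitePercolation (Site 2) half).real (triHCross 0 (2 * n) (2 * n) (n - 1)) *
        (sitePercolation (Site 2) half).real (triHCross 0 (5 * n) (2 * n) (n - 1)) *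
        ((sitePercolation (Site 2) half).real (triVCross 0 (2 * n) n (4 * n - 1)) *
          (sitePercolation (Site 2) half).real (triVCross n (2 * n) n (4 * n - 1))) := by
  obtain ⟨c₀, hc₀, hk⟩ :=
    Summit.CriticalPhenomena.CardyFormulaZ2.Cruxes.IKMixedBoxCrossing.PairedMirrorExploration.HoneycombStub.exists_rsw_const
  have hhalf : 0 < ((half : unitInterval) : ℝ) := by simp [half]
  -- long-way crossings of aspect `≤ 4` by chaining
  have hlong : ∀ h w : ℕ, 1 ≤ h → w ≤ 4 * h → c₀ ^ 3 * c₀ ^ 2 ≤ triLRCrossingProb half w h := fun h w hh hw => by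
    have h₁ : c₀ ≤ triLRCrossingProb half (2 * h) h := (hk h).trans (triLRCrossingProb_anti_width half (by omega) _)
    have h₂ : c₀ ≤ triLRCrossingProb half h h := (hk h).trans (triLRCrossingProb_anti_width half (by omega) _)
    have := pow_mul_pow_le_triLRCrossingProb_of_le half h hc₀.le hc₀.le h₁ h₂ (j := 3) (by norm_num) (w := w)
      (by omega)
    simpa using this
  set cH : ℝ := min (c₀ ^ 3 * c₀ ^ 2) (triLRCrossingProb half 2 0) with hcH
  have hc₁pos : 0 < c₀ ^ 3 * c₀ ^ 2 := by positivity
  have hcHpos : 0 < cH := lt_min hc₁pos (triLRCrossingProb_pos hhalf 2 0)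
  refine ⟨cH * cH * (c₀ ^ 3 * c₀ ^ 2 * (c₀ ^ 3 * c₀ ^ 2)), by positivity, fun n hn => ?_⟩
  have eH : ∀ b : ℤ, (sitePercolation (Site 2) half).real (triHCross 0 b (2 * n) (n - 1)) =
      triLRCrossingProb half (2 * n) (n - 1) := fun b => triSitePercolation_real_triHCross half 0 b _ _
  have eV : ∀ a : ℤ, (sitePercolation (Site 2) half).real (triVCross a (2 * n) n (4 * n - 1)) =
      triLRCrossingProb half (4 * n - 1) n := fun a => triSitePercolation_real_triVCross half a _ _ _
  rw [eH, eH, eV, eV]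
  have hH : cH ≤ triLRCrossingProb half (2 * n) (n - 1) := by
    rcases Nat.lt_or_ge n 2 with h2 | h2
    · interval_cases n
      exact min_le_right _ _
    · exact (min_le_left _ _).trans (hlong (n - 1) (2 * n) (by omega) (by omega))
  have hV : c₀ ^ 3 * c₀ ^ 2 ≤ triLRCrossingProb half (4 * n - 1) n := hlong n (4 * n - 1) hn (by omega)
  have h0 : 0 ≤ triLRCrossingProb half (2 * n) (n - 1) := measureReal_nonneg
  have h0' : 0 ≤ triLRCrossingProb half (4 * n - 1) n := measureReal_nonneg
  calc cH * cH * (c₀ ^ 3 * c₀ ^ 2 * (c₀ ^ 3 * c₀ ^ 2))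
        ≤ triLRCrossingProb half (2 * n) (n - 1) * triLRCrossingProb half (2 * n) (n - 1) *
          (triLRCrossingProb half (4 * n - 1) n * triLRCrossingProb half (4 * n - 1) n) :=
        mul_le_mul (mul_le_mul hH hH hcHpos.le h0) (mul_le_mul hV hV hc₁pos.le h0') (by positivity)
          (mul_nonneg h0 h0)
    _ = _ := by ring

end HonThinRingStub

open HonThinRingStub in
/-- **Stub `stub_honThinRingChain` · THIN RINGS THROUGH THE WALL IN SITE `𝕋`.**  On the all-honeycomb slab of `n + n`
face columns of the cylinder of circumference `8n` (i.i.d. fair colours, anti-diagonals: site percolation on `𝕋` drawn on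
`[0, 2n] × [0, 8n)`), the chained thin-ring event with windows `[2n, 3n)`, `[5n, 6n)` has probability `≥ c > 0` uniformly in
`n ≥ 1`: Harris–FKG for the left–right crossings of `[0, 2n] × [2n, 3n)`, `[0, 2n] × [5n, 6n)` and the bottom–top crossings
of `[0, n] × [2n, 6n)`, `[n, 2n] × [2n, 6n)` (none wraps around the cylinder), RSW on `𝕋` at aspect `≤ 4`, and the gluing
`honCfg_mem_thinRingChain`. -/
theorem stub_honThinRingChain : HonThinRingChain := by
  obtain ⟨c, hc, h⟩ := HonThinRingStub.exists_const_le_prod4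
  refine ⟨c, hc, fun n hn L _ hL => ?_⟩
  subst hL
  exact (h n hn).trans (prod_le_cylProb hn)

end Summit.CriticalPhenomena.CardyFormulaZ2.Theorems.IKLinearTransport.PinnedDiagramExchange.WallDomination

end
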